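import Summits.QuantumFields.BalabanUV.T4Continuum.Support.NE7StabiliserLifting
import Summits.QuantumFields.BalabanUV.T4Continuum.Support.NE7MinimiserLipschitzChart
import HarnessLib

/-!
# NE7MinimiserLipschitzChartSameDatum — THE LIPSCHITZ GAUGE COPY OVER THE SAME DATUM (`d = 4`, every `U(n)`, every `L ≥ 2`): gen 114's
# `NE7MinimiserLipschitzChart.minimiser_lipschitz_chart` (a gauge copy `U^{u} = chart_{U♯} Φ`, `‖Φ‖ ≤ C‖y(V)‖`, with corner values FIXING `V₀`) upgraded by the
# STABILISER LIFTING (`NE7StabiliserLifting.stabiliser_lifting`) to a copy with TRIVIAL corner values `u(L^{j+1}•z) = 1` — so `U^{u}` lies over the SAME datum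
# `V` — with the same constant: the genericity hypothesis of ROAD-G114 §9 (S4)∕(S6) and of `NE7MinimalActionDifferentiable.minAct_hasFDerivAt_generic` is not
# needed, LEVEL BY LEVEL (`∀ j ∃ δ_V`)

Cell `pub-balaban`, rung (B)+1 sub-cell t4, lineage `b2b-balaban-t4-ne7b-p1` (row NE7b OWNER + CRUX PROVER; junction service for row NE7, ruling
R-OWNER-149-1 (2)), generation 158.  File 8 (consumer letter) of the junction census of ROAD-G114 §8's STABILISER DESIGN ISSUE.
THE ARGUMENT.  Gen 114's copy `u` has corner field `ub(z) = u(L^{j+1}•z)` — unitary, `N`-periodic, fixing `V₀`.  The lifting gives `h`, unitary `(N·L^{j+1})`-periodic,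
with `(U♯)^{h} = U♯` and `h(L^{j+1}•z) = ub(z)`; then `u′ := h⁻¹u` has trivial corners and `U^{u′} = ((U♯)·e^{Φ})^{h⁻¹} = U♯·e^{Φ′}` with
`Φ′(r,κ) = Ad_{h(boxVec r + e_κ)⁻¹} Φ(r,κ)` (`NE7SymmetricFermat.chart_dress` at the fixed base `U♯`), `‖Φ′‖ = ‖Φ‖` (unitary conjugation is isometric).
WHAT ([folklore]; 0 def, 0 sorry).  §1 `chart_id_eq_chart_skewP` (the two chart inserts agree on `𝔲(n)` parameters), `norm_dress_le`; §2
**`minimiser_lipschitz_chart_sameDatum`**; §3 **`minimisers_conj_trivial_corners`** (the minimal orbit over `V₀` is ONE orbit of the trivial-corner gauges).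
HONEST FRAMING (page 1): a re-assembly of gen 114's Lipschitz theorem and this lineage's lifting theorem; the datum radius `δ_V` depends on the level `j` (inherited from
`stabiliser_lifting`); constants existential; OUR minimisers ∕ OUR route, nothing of Bałaban's asserted; NOT NE7 as a spine node, NOT NE3, row NE7b NOT PRINTED ∕ NOT
PROVED; spine 0∕9; finite T⁴ rung (B)+1 — NOT infinite volume, NOT mass gap, NOT BetaPertH, NOT Clay (continuum YM on T⁴ ⇐ BetaPertH ∧ nine spine estimates).
-/

set_option autoImplicit false

open scoped BigOperators Matrix Matrix.Norms.L2Operator Topology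
open NormedSpace Finset Set Filter

namespace Summit.QuantumFields.BalabanUV.T4Continuum.NE7MinimiserLipschitzChartSameDatum

open Literature.MathematicalPhysics.QuantumFieldTheory.Balaban1983to89
open B7Prop1Explicit B7Prop2Explicit
open T4AveragingDeficitWall (IsUnitaryCfg SmallField Ad)
open T4AveragingDeficitWallBoundary (IsPeriodicCfg)
open AveragingDeficitTorusChart (TDir chart chartDir skewP skewP_of_mem)
open AveragingDeficitChartCalculus (relLog)
open AveragingDeficitTwoLevelPrep (skewSub skewPR)
open AveragingDeficitMultiLevelPrep (tower)
open AveragingDeficitTransport (norm_Ad_of_unitary Ad_mem_skewAdjoint)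
open AveragingDeficitKDatum (gaugeAct_inv_gaugeAct)
open MinimalActionSandwich (IsMinimiser)
open MinimalActionRate (sfClass)
open NE3EnergyShapes (IsUnitarySite IsPeriodicSite)
open NE7AdmissibleFibreLHC (period_succ_eq)
open NE7MinimiserLipschitzChart (minimiser_lipschitz_chart)
open NE7SymmetricFermat (chart_dress)
open NE7StabiliserLifting (stabiliser_lifting gaugeAct_mul isPeriodicSite_corner)

noncomputable section

variable {n : Type} [Fintype n] [DecidableEq n]

/-! ## §1 Two small letters -/

/-- The chart with the identity insert agrees with the chart with the `𝔲(n)` insert on `𝔲(n)`-valued parameters. [folklore] -/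
theorem chart_id_eq_chart_skewP {d : ℕ} (N : ℕ) [NeZero N] (V : Site d → Fin d → (Matrix n n ℂ)ˣ) (Φ : ↥(skewSub d n N)) :
    chart (ContinuousLinearMap.id ℝ (Matrix n n ℂ)) N V (Φ : TDir d n N) = chart skewP N V (Φ : TDir d n N) := by
  funext x κ
  simp only [chart, chartDir, ContinuousLinearMap.id_apply, skewP_of_mem (Φ.2 _ _)]

/-- A unitarily dressed parameter has the same (sup) norm bound. [folklore] -/
theorem norm_dress_le {d : ℕ} (N : ℕ) {w : (Fin d → Fin N) → Fin d → (Matrix n n ℂ)ˣ} (hw : ∀ r κ, w r κ ∈ unitaryUnits (Matrix n n ℂ))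
    (Φ : TDir d n N) : ‖(fun r κ => Ad (w r κ) (Φ r κ) : TDir d n N)‖ ≤ ‖Φ‖ := by
  refine (pi_norm_le_iff_of_nonneg (norm_nonneg _)).2 fun r => (pi_norm_le_iff_of_nonneg (norm_nonneg _)).2 fun κ => ?_
  rw [norm_Ad_of_unitary (hw r κ)]
  exact (norm_le_pi_norm (Φ r) κ).trans (norm_le_pi_norm Φ r)

/-! ## §2 The Lipschitz copy over the same datum -/

/-- **THE LIPSCHITZ GAUGE COPY OF A MINIMISER OVER A NEARBY DATUM CAN BE TAKEN OVER THE SAME DATUM** (`d = 4`, every `U(n)`, every `L ≥ 2`): for `0 < ε ≤ ε₀(n, L)`,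
`N ≥ 1` and every level `j+1` there is `δ_V > 0` such that over every unitary `N`-periodic `V₀` with `SmallField V₀ δ_V` there are a minimiser `U♯` over `V₀` and `C ≥ 0`
with: EVENTUALLY as the unitary `N`-periodic datum `V → V₀`, every constrained minimiser `U` over `V` has a unitary `(N·L^{j+1})`-periodic gauge copy `U^{u}` whose corner
values are TRIVIAL (`u(L^{j+1}•z) = 1`, so `U^{u}` is again a minimiser OVER `V`), of the form `chart_{U♯} Φ` with `‖Φ‖ ≤ C·‖skewPR N (relLog N V₀ V)‖`. [folklore] -/
theorem minimiser_lipschitz_chart_sameDatum [Nonempty n] {L : ℕ} [NeZero L] (hL : 2 ≤ L) :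
    ∃ ε₀ : ℝ, 0 < ε₀ ∧ ∀ ε : ℝ, 0 < ε → ε ≤ ε₀ → ∀ (N : ℕ) [NeZero N], 1 ≤ N → ∀ j : ℕ,
      ∃ δV : ℝ, 0 < δV ∧
        ∀ V₀ ∈ {V : Site 4 → Fin 4 → (Matrix n n ℂ)ˣ | IsUnitaryCfg V ∧ IsPeriodicCfg V (N : ℤ) ∧ SmallField V δV},
        ∃ Us : Site 4 → Fin 4 → (Matrix n n ℂ)ˣ, IsMinimiser 4 (sfClass 4 L N ε) L N (j + 1) V₀ Us ∧ ∃ C : ℝ, 0 ≤ C ∧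
          ∀ᶠ V in 𝓝 V₀, IsUnitaryCfg V → IsPeriodicCfg V (N : ℤ) →
            ∀ U : Site 4 → Fin 4 → (Matrix n n ℂ)ˣ, IsMinimiser 4 (sfClass 4 L N ε) L N (j + 1) V U →
              ∃ (u : Site 4 → (Matrix n n ℂ)ˣ) (Φ : ↥(skewSub 4 n (L * tower L N j))), IsUnitarySite u ∧ IsPeriodicSite u ((N * L ^ (j + 1) : ℕ) : ℤ) ∧
                (∀ z : Site 4, u (((L : ℤ) ^ (j + 1)) • z) = 1) ∧
                gaugeAct u U = chart (ContinuousLinearMap.id ℝ (Matrix n n ℂ)) (L * tower L N j) Us (Φ : TDir 4 n (L * tower L N j)) ∧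
                ‖Φ‖ ≤ C * ‖skewPR N (relLog N V₀ V)‖ := by
  have hL1 : 1 ≤ L := by omega
  obtain ⟨ε₁, hε₁, H1⟩ := minimiser_lipschitz_chart (n := n) hL
  obtain ⟨ε₂, hε₂, H2⟩ := stabiliser_lifting (n := n) hL
  refine ⟨min ε₁ ε₂, lt_min hε₁ hε₂, fun ε hε hεle N _ hN j => ?_⟩
  obtain ⟨δ₁, hδ₁, hlip⟩ := H1 ε hε (hεle.trans (min_le_left _ _)) N hN
  obtain ⟨δ₂, hδ₂, hlift⟩ := H2 ε hε (hεle.trans (min_le_right _ _)) N hN (j + 1)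
  refine ⟨min δ₁ δ₂, lt_min hδ₁ hδ₂, fun V₀ hV₀ => ?_⟩
  obtain ⟨hV₀u, hV₀P, hV₀δ⟩ := hV₀
  have hV₀1 : V₀ ∈ {V : Site 4 → Fin 4 → (Matrix n n ℂ)ˣ | IsUnitaryCfg V ∧ IsPeriodicCfg V (N : ℤ) ∧ SmallField V δ₁} :=
    ⟨hV₀u, hV₀P, MinimalActionRate.SmallField.mono hV₀δ (min_le_left _ _)⟩
  have hV₀2 : V₀ ∈ {V : Site 4 → Fin 4 → (Matrix n n ℂ)ˣ | IsUnitaryCfg V ∧ IsPeriodicCfg V (N : ℤ) ∧ SmallField V δ₂} :=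
    ⟨hV₀u, hV₀P, MinimalActionRate.SmallField.mono hV₀δ (min_le_right _ _)⟩
  obtain ⟨Us, hUs, C, hC, hev⟩ := hlip V₀ hV₀1 j
  refine ⟨Us, hUs, C, hC, ?_⟩
  set M : ℕ := L * tower L N j with hMdef
  have hper : N * L ^ (j + 1) = M := by rw [hMdef]; exact period_succ_eq L N j
  haveI : NeZero M := ⟨by rw [← hper]; exact Nat.mul_ne_zero (NeZero.ne N) (pow_ne_zero _ (by omega))⟩
  have hcast : (((L ^ (j + 1) : ℕ) : ℤ)) = (L : ℤ) ^ (j + 1) := by push_cast; ring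
  filter_upwards [hev] with V hV hVu hVP U hU
  obtain ⟨u, Φ, hu, huP, hcorner, hcopy, hΦ⟩ := hV hVu hVP U hU
  -- the corner field of `u` fixes `V₀`; lift it at the minimiser `U♯`
  set ub : Site 4 → (Matrix n n ℂ)ˣ := fun z => u (((L : ℤ) ^ (j + 1)) • z) with hub
  have hubu : IsUnitarySite ub := fun z => hu _
  have hubP : IsPeriodicSite ub (N : ℤ) := by
    have h := isPeriodicSite_corner (n := n) (M := L ^ (j + 1)) (N := N) (u := u) (by simpa only using huP)
    simp only [hcast] at h
    exact h
  have hubfix : gaugeAct ub V₀ = V₀ := by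
    funext z κ
    apply Units.ext
    have h := hcorner z κ
    simp only [gaugeAct, hub, Units.val_mul]
    exact h
  obtain ⟨h, hhu, hhP, hhfix, hhcorner⟩ := hlift V₀ hV₀2 Us hUs ub hubu hubP hubfix
  have hhP' : IsPeriodicSite h (M : ℤ) := by rw [← hper]; exact hhP
  have hhinv_u : IsUnitarySite (fun x => (h x)⁻¹) := fun x => (unitaryUnits (Matrix n n ℂ)).inv_mem (hhu x)
  have hhinv_P : IsPeriodicSite (fun x => (h x)⁻¹) (M : ℤ) := fun x i => by simp only [hhP' x i]
  have hhinv_fix : gaugeAct (fun x => (h x)⁻¹) Us = Us := by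
    conv_lhs => rw [← hhfix]
    exact gaugeAct_inv_gaugeAct h Us
  -- the dressed parameter
  let Φ' : ↥(skewSub 4 n M) :=
    ⟨fun r κ => Ad ((h (boxVec M r + e κ))⁻¹) ((Φ : TDir 4 n M) r κ),
      fun r κ => Ad_mem_skewAdjoint ((unitaryUnits (Matrix n n ℂ)).inv_mem (hhu _)) (Φ.2 r κ)⟩
  refine ⟨fun x => (h x)⁻¹ * u x, Φ', fun x => (unitaryUnits (Matrix n n ℂ)).mul_mem ((unitaryUnits (Matrix n n ℂ)).inv_mem (hhu x)) (hu x),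
    fun x i => by simp only [hhP x i, huP x i], fun z => ?_, ?_, ?_⟩
  · show (h (((L : ℤ) ^ (j + 1)) • z))⁻¹ * u (((L : ℤ) ^ (j + 1)) • z) = 1
    rw [hhcorner z, hub, inv_mul_cancel]
  · rw [gaugeAct_mul, hcopy, chart_id_eq_chart_skewP, chart_id_eq_chart_skewP]
    exact (chart_dress M hhinv_u hhinv_P hhinv_fix (Φ : TDir 4 n M)).symm
  · exact (norm_dress_le M (fun r κ => (unitaryUnits (Matrix n n ℂ)).inv_mem (hhu _)) (Φ : TDir 4 n M)).trans hΦ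

/-! ## §3 Any two minimisers over the same datum differ by a gauge transformation with trivial corners -/

/-- **THE MINIMAL ORBIT IS ONE ORBIT OF THE TRIVIAL-CORNER GAUGES** (`d = 4`, every `U(n)`, every `L ≥ 2`): for `0 < ε ≤ ε₀(n, L)`, `N ≥ 1` and every level `k` there is
`δ_V > 0` such that over every unitary `N`-periodic `V₀` with `SmallField V₀ δ_V`, any two minimisers `U₁`, `U₂` of `sfClass 4 L N ε` at level `k` over `V₀` satisfy
`U₁^{w} = U₂` for a unitary `(N·L^k)`-periodic `w` with TRIVIAL corner values `w(L^k•z) = 1`. [folklore] -/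
theorem minimisers_conj_trivial_corners [Nonempty n] {L : ℕ} (hL : 2 ≤ L) :
    ∃ ε₀ : ℝ, 0 < ε₀ ∧ ∀ ε : ℝ, 0 < ε → ε ≤ ε₀ → ∀ (N : ℕ) [NeZero N], 1 ≤ N → ∀ k : ℕ, ∃ δV : ℝ, 0 < δV ∧
      ∀ V₀ ∈ {V : Site 4 → Fin 4 → (Matrix n n ℂ)ˣ | IsUnitaryCfg V ∧ IsPeriodicCfg V (N : ℤ) ∧ SmallField V δV},
      ∀ U₁ U₂ : Site 4 → Fin 4 → (Matrix n n ℂ)ˣ, IsMinimiser 4 (sfClass 4 L N ε) L N k V₀ U₁ → IsMinimiser 4 (sfClass 4 L N ε) L N k V₀ U₂ →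
        ∃ w : Site 4 → (Matrix n n ℂ)ˣ, IsUnitarySite w ∧ IsPeriodicSite w ((N * L ^ k : ℕ) : ℤ) ∧ (∀ z : Site 4, w (((L : ℤ) ^ k) • z) = 1) ∧
          gaugeAct w U₁ = U₂ := by
  classical
  haveI : NeZero L := ⟨by omega⟩
  have hL1 : 1 ≤ L := by omega
  obtain ⟨ε₁, hε₁, H1⟩ := NE7StabiliserLifting.exists_fixed_minimiser (n := n) hL
  obtain ⟨ε₂, hε₂, H2⟩ := stabiliser_lifting (n := n) hL
  obtain ⟨θ₀, CF, CE, hθ₀, -, -, -, -, -, hlsP, -, -⟩ := NE7EnergyClassPoincareGeneric.classPackage (n := n) (d := 4) (by norm_num) hL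
  refine ⟨min ε₁ (min ε₂ θ₀), lt_min hε₁ (lt_min hε₂ hθ₀), fun ε hε hεle N _ hN k => ?_⟩
  have hεθ : ε ≤ θ₀ := hεle.trans ((min_le_right _ _).trans (min_le_right _ _))
  have hls : ∀ j : ℕ, AveragingDeficitMultiLevelPrep.LevelSmall 4 L j (ε / ((L : ℝ) ^ (j + 1)) ^ 2) := hlsP hε.le hεθ
  obtain ⟨δ₁, hδ₁, hfix⟩ := H1 ε hε (hεle.trans (min_le_left _ _)) N hN k
  obtain ⟨δ₂, hδ₂, hlift⟩ := H2 ε hε (hεle.trans ((min_le_right _ _).trans (min_le_left _ _))) N hN k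
  refine ⟨min δ₁ δ₂, lt_min hδ₁ hδ₂, fun V₀ hV₀ U₁ U₂ hU₁ hU₂ => ?_⟩
  obtain ⟨hV₀u, hV₀P, hV₀δ⟩ := hV₀
  have hV₀1 : V₀ ∈ {V : Site 4 → Fin 4 → (Matrix n n ℂ)ˣ | IsUnitaryCfg V ∧ IsPeriodicCfg V (N : ℤ) ∧ SmallField V δ₁} :=
    ⟨hV₀u, hV₀P, MinimalActionRate.SmallField.mono hV₀δ (min_le_left _ _)⟩
  have hV₀2 : V₀ ∈ {V : Site 4 → Fin 4 → (Matrix n n ℂ)ˣ | IsUnitaryCfg V ∧ IsPeriodicCfg V (N : ℤ) ∧ SmallField V δ₂} :=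
    ⟨hV₀u, hV₀P, MinimalActionRate.SmallField.mono hV₀δ (min_le_right _ _)⟩
  obtain ⟨UK, -, -, hcopy⟩ := hfix V₀ hV₀1
  obtain ⟨u₁, hu₁, hu₁P, hg₁⟩ := hcopy U₁ hU₁
  obtain ⟨u₂, hu₂, hu₂P, hg₂⟩ := hcopy U₂ hU₂
  have hLk0 : ((L : ℤ) ^ k) ≠ 0 := pow_ne_zero _ (by exact_mod_cast (by omega : L ≠ 0))
  have hcast : (((L ^ k : ℕ) : ℤ)) = (L : ℤ) ^ k := by push_cast; ring
  -- `w₀ := u₂⁻¹ u₁` maps `U₁` to `U₂`; its corner field fixes `V₀`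
  set w₀ : Site 4 → (Matrix n n ℂ)ˣ := fun x => (u₂ x)⁻¹ * u₁ x with hw₀
  have hw₀u : IsUnitarySite w₀ := fun x =>
    (unitaryUnits (Matrix n n ℂ)).mul_mem ((unitaryUnits (Matrix n n ℂ)).inv_mem (hu₂ x)) (hu₁ x)
  have hw₀P : IsPeriodicSite w₀ ((N * L ^ k : ℕ) : ℤ) := fun x i => by simp only [hw₀, hu₁P x i, hu₂P x i]
  have hw₀g : gaugeAct w₀ U₁ = U₂ := by
    rw [hw₀, gaugeAct_mul, hg₁, ← hg₂, gaugeAct_inv_gaugeAct]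
  set c : Site 4 → (Matrix n n ℂ)ˣ := fun z => w₀ (((L : ℤ) ^ k) • z) with hc
  have hcu : IsUnitarySite c := fun z => hw₀u _
  have hcP : IsPeriodicSite c (N : ℤ) := by
    have h := isPeriodicSite_corner (n := n) (M := L ^ k) (N := N) (u := w₀) (by simpa only using hw₀P)
    simp only [hcast] at h
    exact h
  have hcfix : gaugeAct c V₀ = V₀ := by
    cases k with
    | zero =>
        have h1 : U₁ = V₀ := hU₁.mem.2
        have h2 : U₂ = V₀ := hU₂.mem.2
        have hcw : c = w₀ := by funext z; simp only [hc, pow_zero, one_smul]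
        rw [hcw]
        have h := hw₀g
        rw [h1, h2] at h
        exact h
    | succ j =>
        obtain ⟨⟨hUu, hUP, hUε⟩, hUavg⟩ := hU₁.mem
        have hx : 0 ≤ ε / ((L : ℝ) ^ (j + 1)) ^ 2 := by positivity
        have h1 := NE3CpushGaugeCovariance.cavgIter_gaugeAct (d := 4) hL1 j hUu hx (hls j) hUε (u := w₀) hw₀u
        rw [hw₀g, AveragingDeficitMultiLevelBridge.cavgIter_eq_avgIter, AveragingDeficitMultiLevelBridge.cavgIter_eq_avgIter, hU₂.mem.2, hUavg] at h1
        exact h1.symm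
  -- lift the corner field at `U₂` and kill the corners
  obtain ⟨h, hhu, hhP, hhfix, hhcorner⟩ := hlift V₀ hV₀2 U₂ hU₂ c hcu hcP hcfix
  refine ⟨fun x => (h x)⁻¹ * w₀ x, fun x => (unitaryUnits (Matrix n n ℂ)).mul_mem ((unitaryUnits (Matrix n n ℂ)).inv_mem (hhu x)) (hw₀u x),
    fun x i => by simp only [hhP x i, hw₀P x i], fun z => ?_, ?_⟩
  · show (h (((L : ℤ) ^ k) • z))⁻¹ * w₀ (((L : ℤ) ^ k) • z) = 1
    rw [hhcorner z, hc, inv_mul_cancel]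
  · rw [gaugeAct_mul, hw₀g, ← hhfix, gaugeAct_inv_gaugeAct, hhfix]

end

end Summit.QuantumFields.BalabanUV.T4Continuum.NE7MinimiserLipschitzChartSameDatum
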